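import Summits.CriticalPhenomena.PercolationContinuityZ3.Theorems.FreeBoxPowerSaving.Negative.FreeBoxPowerSavingBounds
import Literature.Probability.Percolation.SeedLemma
import Literature.Probability.Percolation.RSW

/-!
# Negative / tightness lemmas for the crux `FreeBoxPowerSaving` (stmt-CriticalPhenomena-4447), V:
# quasi-giants under the crux — the registered skeleton's open stub is crux-necessary

Supports (does not close) the crux `PercNonProliferation.FreeBoxPowerSaving`.  Standing-disprover
(cdisprove cycle 3) audit of the checked skeleton
`Cruxes/FreeBoxPowerSaving/Lines/tightness-collapse-typical-kmax.lean` (skeleton `c888e645…`, stubs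
`stub_sizeSplitting`, `stub_logBoost`, `stub_gluingCriterion`, `stub_noCriticalFoam`), landed from the
work file `Cruxes/FreeBoxPowerSaving/Disproof.lean` §11; sorry-free.  Events are written VERBATIM as
in the registered stubs (`(box 3 n).filter fun v => ω ∈ openConnIn ↑(box 3 n) u v` is the free-box
piece of `u`).  Part VI (`FreeBoxPowerSavingStubGuards.lean`) has the stubs' load-bearing guards and
the archived sibling skeleton's `stub_fatFiniteClusters`.

* `sq_le_sum_indicator`, `measureReal_quasiGiant_le` — the second-moment Markov inequality
  `P_p(some free-box piece of B(n) has ≥ t vertices) ≤ S_p(n) / t²` (`S_p(n) = pairSum p n`,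
  `t > 0`): a piece with `≥ t` vertices contributes `≥ t²` ordered joined pairs.
* `measureReal_quasiGiant_rpow_le` — under a power saving `fa2 p n ≤ C n^{-a₀}` the quasi-giant
  event `QG(n, n^b)` has probability `≤ 729 C n^{6 - a₀ - 2b}`.
* `quasiGiant_tendsto_zero_of_freeBoxPowerSaving`, `quasiGiantNotAS_of_freeBoxPowerSaving` — the
  crux implies the hypothesis of `stub_logBoost` ("QG-NAS": `P_{p_c}(QG(n, n^{3-a})) ≤ 1 - ε`
  eventually, indeed `→ 0`, with `a = a₀/4`): modulo size splitting + log boost the crux is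
  EQUIVALENT to QG-NAS.
* `foam_subset_quasiGiant`, `noCriticalFoam_of_freeBoxPowerSaving` — the crux implies the open stub
  `stub_noCriticalFoam` VERBATIM: the open stub is necessary, so it cannot be refuted without
  refuting the crux (and conversely the skeleton proves it sufficient modulo three provable stubs).
* `foam_iff_two_fat_outer` — structural identity: the foam event (a fat inner piece NOT glued inside
  `B(2n)` to a fat outer piece) is exactly "a fat inner piece exists AND `B(2n)` carries two distinct
  fat pieces": `stub_noCriticalFoam` is a NON-PROLIFERATION statement (`≤ 1` fat piece of `B(2n)` at
  aspect ratio 2, given a fat piece of `B(n)`), the volume cousin of the route's r2 `NonProliferation`.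
* `boundaryQuasiGiantsNotAS_of_freeBoxPowerSaving` — the archived sibling skeleton's hardest stub
  `stub_boundaryQuasiGiantsNotAS` VERBATIM from the crux (`ε = 1/2`): crux-necessary as well.
-/

namespace Summit.CriticalPhenomena.PercolationContinuityZ3.FreeBoxPowerSavingNegative

open MeasureTheory ProbabilityTheory Filter
open Literature.Probability.Percolation Literature.Probability.LatticeModels
open Summit.CriticalPhenomena.PercolationContinuityZ3.Theses.PercNonProliferation
open scoped BigOperators Topology Classical

noncomputable section

/-! ## The quasi-giant event and the second-moment Markov bound -/

/-- `QG(n, t)`: some `u ∈ B(n)` is joined inside `B(n)` to at least `t` vertices of `B(n)` (the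
registered stubs' quasi-giant event, verbatim). -/
def quasiGiant (n : ℕ) (t : ℝ) : Set (BondConfig (Site 3)) :=
  {ω | ∃ u ∈ box 3 n, t ≤ (((box 3 n).filter fun v => ω ∈ openConnIn ↑(box 3 n) u v).card : ℝ)}

/-- Symmetry of `{x ↔ y in S}` (membership form). -/
theorem openConnIn_symm_mem {S : Set (Site 3)} {x y : Site 3} {ω : BondConfig (Site 3)}
    (h : ω ∈ openConnIn S x y) : ω ∈ openConnIn S y x := by
  obtain ⟨hx, hy, hr⟩ := h
  exact ⟨hy, hx, hr.symm⟩

/-- **A piece with `≥ t` vertices gives `≥ t²` ordered joined pairs**: on `QG(n, t)` (`t ≥ 0`),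
`t² ≤ Σ_{x,y ∈ B(n)} 1{x ↔ y in B(n)}`. -/
theorem sq_le_sum_indicator {n : ℕ} {t : ℝ} (ht : 0 ≤ t) {ω : BondConfig (Site 3)}
    (hω : ω ∈ quasiGiant n t) :
    t ^ 2 ≤ ∑ x ∈ box 3 n, ∑ y ∈ box 3 n,
      (openConnIn (↑(box 3 n) : Set (Site 3)) x y).indicator (fun _ => (1 : ℝ)) ω := by
  obtain ⟨u, -, htu⟩ := hω
  set P : Finset (Site 3) := (box 3 n).filter fun v => ω ∈ openConnIn ↑(box 3 n) u v
  have hPsub : P ⊆ box 3 n := Finset.filter_subset _ _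
  have hconn : ∀ v ∈ P, ω ∈ openConnIn (↑(box 3 n) : Set (Site 3)) u v := fun v hv =>
    (Finset.mem_filter.1 hv).2
  have hone : ∀ x ∈ P, ∀ y ∈ P,
      (openConnIn (↑(box 3 n) : Set (Site 3)) x y).indicator (fun _ => (1 : ℝ)) ω = 1 := by
    intro x hx y hy
    have hxy : ω ∈ openConnIn (↑(box 3 n) : Set (Site 3)) x y :=
      GM.openConnIn_trans (openConnIn_symm_mem (hconn x hx)) (hconn y hy)
    rw [Set.indicator_of_mem hxy]
  have hnn : ∀ x y, 0 ≤ (openConnIn (↑(box 3 n) : Set (Site 3)) x y).indicator (fun _ => (1 : ℝ)) ω :=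
    fun x y => Set.indicator_nonneg (fun _ _ => zero_le_one) _
  calc t ^ 2 ≤ ((P.card : ℝ)) ^ 2 := pow_le_pow_left₀ ht htu 2
    _ = ∑ _x ∈ P, ∑ _y ∈ P, (1 : ℝ) := by
        simp only [Finset.sum_const, nsmul_eq_mul, mul_one, sq]
    _ = ∑ x ∈ P, ∑ y ∈ P, (openConnIn (↑(box 3 n) : Set (Site 3)) x y).indicator (fun _ => (1 : ℝ)) ω :=
        Finset.sum_congr rfl fun x hx => Finset.sum_congr rfl fun y hy => (hone x hx y hy).symm
    _ ≤ ∑ x ∈ P, ∑ y ∈ box 3 n, (openConnIn (↑(box 3 n) : Set (Site 3)) x y).indicator (fun _ => (1 : ℝ)) ω :=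
        Finset.sum_le_sum fun x _ =>
          Finset.sum_le_sum_of_subset_of_nonneg hPsub fun y _ _ => hnn x y
    _ ≤ ∑ x ∈ box 3 n, ∑ y ∈ box 3 n, (openConnIn (↑(box 3 n) : Set (Site 3)) x y).indicator (fun _ => (1 : ℝ)) ω :=
        Finset.sum_le_sum_of_subset_of_nonneg hPsub fun x _ _ => Finset.sum_nonneg fun y _ => hnn x y

/-- **Second-moment Markov bound**: `P_p(QG(n, t)) ≤ S_p(n) / t²` for `t > 0`, where
`S_p(n) = Σ_{x,y ∈ B(n)} P_p(x ↔ y in B(n)) = pairSum p n`. -/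
theorem measureReal_quasiGiant_le (p : unitInterval) (n : ℕ) {t : ℝ} (ht : 0 < t) :
    (bondPercolation (zdGraph 3) p).real (quasiGiant n t) ≤ pairSum p n / t ^ 2 := by
  set μ := bondPercolation (zdGraph 3) p with hμ
  have hmeas : ∀ x y : Site 3, MeasurableSet (openConnIn (↑(box 3 n) : Set (Site 3)) x y) :=
    fun x y => DCT16.measurableSet_openConnIn (box 3 n) x y
  have hint1 : ∀ x y : Site 3,
      Integrable (fun ω => (openConnIn (↑(box 3 n) : Set (Site 3)) x y).indicator (fun _ => (1 : ℝ)) ω) μ :=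
    fun x y => (integrable_const (1 : ℝ)).indicator (hmeas x y)
  have hint2 : ∀ x : Site 3, Integrable (fun ω => ∑ y ∈ box 3 n,
      (openConnIn (↑(box 3 n) : Set (Site 3)) x y).indicator (fun _ => (1 : ℝ)) ω) μ :=
    fun x => integrable_finsetSum _ fun y _ => hint1 x y
  have hN_int : Integrable (fun ω => ∑ x ∈ box 3 n, ∑ y ∈ box 3 n,
      (openConnIn (↑(box 3 n) : Set (Site 3)) x y).indicator (fun _ => (1 : ℝ)) ω) μ :=
    integrable_finsetSum _ fun x _ => hint2 x
  have hN_nonneg : 0 ≤ᵐ[μ] fun ω => ∑ x ∈ box 3 n, ∑ y ∈ box 3 n,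
      (openConnIn (↑(box 3 n) : Set (Site 3)) x y).indicator (fun _ => (1 : ℝ)) ω :=
    ae_of_all _ fun ω => Finset.sum_nonneg fun x _ => Finset.sum_nonneg fun y _ =>
      Set.indicator_nonneg (fun _ _ => zero_le_one) _
  have hN_integral : ∫ ω, (∑ x ∈ box 3 n, ∑ y ∈ box 3 n,
      (openConnIn (↑(box 3 n) : Set (Site 3)) x y).indicator (fun _ => (1 : ℝ)) ω) ∂μ = pairSum p n := by
    rw [integral_finsetSum _ fun x _ => hint2 x]
    unfold pairSum
    refine Finset.sum_congr rfl fun x _ => ?_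
    rw [integral_finsetSum _ fun y _ => hint1 x y]
    refine Finset.sum_congr rfl fun y _ => ?_
    rw [integral_indicator_const (1 : ℝ) (hmeas x y), smul_eq_mul, mul_one]
  have hmarkov := mul_meas_ge_le_integral_of_nonneg hN_nonneg hN_int (t ^ 2)
  rw [hN_integral] at hmarkov
  have hsub : quasiGiant n t ⊆ {ω | t ^ 2 ≤ ∑ x ∈ box 3 n, ∑ y ∈ box 3 n,
      (openConnIn (↑(box 3 n) : Set (Site 3)) x y).indicator (fun _ => (1 : ℝ)) ω} :=
    fun ω hω => sq_le_sum_indicator ht.le hω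
  have ht2 : 0 < t ^ 2 := pow_pos ht 2
  calc μ.real (quasiGiant n t)
      ≤ μ.real {ω | t ^ 2 ≤ ∑ x ∈ box 3 n, ∑ y ∈ box 3 n,
          (openConnIn (↑(box 3 n) : Set (Site 3)) x y).indicator (fun _ => (1 : ℝ)) ω} :=
        measureReal_mono hsub (measure_ne_top _ _)
    _ ≤ pairSum p n / t ^ 2 := by
        rw [le_div_iff₀ ht2, mul_comm]
        exact hmarkov

/-- `C ≥ 0` for any constant of a power saving (since `fa2 ≥ 0`). -/
theorem const_nonneg_of_powerSaving {p : unitInterval} {a₀ C : ℝ}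
    (hC : ∀ n : ℕ, 1 ≤ n → fa2 p n ≤ C * (n : ℝ) ^ (-a₀)) : 0 ≤ C := by
  have h := (fa2_nonneg p 1).trans (hC 1 le_rfl)
  simp only [Nat.cast_one, Real.one_rpow, mul_one] at h
  exact h

/-- **Under a power saving, quasi-giants are polynomially unlikely**: if `fa2 p n ≤ C n^{-a₀}` for
`n ≥ 1`, then `P_p(QG(n, n^b)) ≤ 729 C n^{6 - a₀ - 2b}` for `n ≥ 1`. -/
theorem measureReal_quasiGiant_rpow_le {p : unitInterval} {a₀ C : ℝ}
    (hC : ∀ n : ℕ, 1 ≤ n → fa2 p n ≤ C * (n : ℝ) ^ (-a₀)) {n : ℕ} (hn : 1 ≤ n) (b : ℝ) :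
    (bondPercolation (zdGraph 3) p).real (quasiGiant n ((n : ℝ) ^ b)) ≤
      729 * C * (n : ℝ) ^ (6 - a₀ - 2 * b) := by
  have hn1 : (1 : ℝ) ≤ n := by exact_mod_cast hn
  have hnpos : (0 : ℝ) < n := by linarith
  have ht : 0 < (n : ℝ) ^ b := Real.rpow_pos_of_pos hnpos b
  have h1 := measureReal_quasiGiant_le p n ht
  have hcard := card_box_pos n
  have hC0 : 0 ≤ C := const_nonneg_of_powerSaving hC
  have hps : pairSum p n ≤ C * (n : ℝ) ^ (-a₀) * ((box 3 n).card : ℝ) ^ 2 := by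
    have := hC n hn
    unfold fa2 at this
    rwa [div_le_iff₀ (pow_pos hcard 2)] at this
  have hcard2 : ((box 3 n).card : ℝ) ^ 2 ≤ 729 * (n : ℝ) ^ 6 := by
    rw [card_box_real]
    have h3 : 2 * (n : ℝ) + 1 ≤ 3 * n := by linarith
    calc ((2 * (n : ℝ) + 1) ^ 3) ^ 2 = (2 * (n : ℝ) + 1) ^ 6 := by ring
      _ ≤ (3 * (n : ℝ)) ^ 6 := by gcongr
      _ = 729 * (n : ℝ) ^ 6 := by ring
  have hK : 0 ≤ C * (n : ℝ) ^ (-a₀) := mul_nonneg hC0 (Real.rpow_nonneg hnpos.le _)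
  have hnum : pairSum p n ≤ C * (n : ℝ) ^ (-a₀) * (729 * (n : ℝ) ^ 6) :=
    hps.trans (mul_le_mul_of_nonneg_left hcard2 hK)
  have hsq : ((n : ℝ) ^ b) ^ 2 = (n : ℝ) ^ (2 * b) := by
    rw [← Real.rpow_natCast ((n : ℝ) ^ b) 2, ← Real.rpow_mul hnpos.le]
    congr 1
    push_cast
    ring
  have hpow : (n : ℝ) ^ (-a₀) * (n : ℝ) ^ 6 / (n : ℝ) ^ (2 * b) = (n : ℝ) ^ (6 - a₀ - 2 * b) := by
    rw [← Real.rpow_natCast (n : ℝ) 6, ← Real.rpow_add hnpos, ← Real.rpow_sub hnpos]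
    congr 1
    push_cast
    ring
  calc (bondPercolation (zdGraph 3) p).real (quasiGiant n ((n : ℝ) ^ b))
      ≤ pairSum p n / ((n : ℝ) ^ b) ^ 2 := h1
    _ ≤ C * (n : ℝ) ^ (-a₀) * (729 * (n : ℝ) ^ 6) / ((n : ℝ) ^ b) ^ 2 :=
        div_le_div_of_nonneg_right hnum (pow_pos ht 2).le
    _ = 729 * C * ((n : ℝ) ^ (-a₀) * (n : ℝ) ^ 6 / (n : ℝ) ^ (2 * b)) := by rw [hsq]; ring
    _ = 729 * C * (n : ℝ) ^ (6 - a₀ - 2 * b) := by rw [hpow]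

/-! ## The crux implies the `stub_logBoost` hypothesis (QG-NAS) and the open stub `stub_noCriticalFoam` -/

/-- **Crux ⟹ quasi-giants vanish** (the converse of the line's collapse): under the crux with
exponent `a₀`, `P_{p_c}(QG(n, n^{3-a})) → 0` for `a = a₀ / 4` (indeed for every `a < a₀ / 2`). -/
theorem quasiGiant_tendsto_zero_of_freeBoxPowerSaving (h : FreeBoxPowerSaving) :
    ∃ a : ℝ, 0 < a ∧ Tendsto (fun n : ℕ => (bondPercolation (zdGraph 3) (criticalProbI 3)).real
      {ω | ∃ u ∈ box 3 n, (n : ℝ) ^ (3 - a) ≤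
        (((box 3 n).filter fun v => ω ∈ openConnIn ↑(box 3 n) u v).card : ℝ)}) atTop (𝓝 0) := by
  obtain ⟨a₀, C, ha₀, hC⟩ := freeBoxPowerSaving_iff_fa2.1 h
  refine ⟨a₀ / 4, by linarith, ?_⟩
  have hlim : Tendsto (fun n : ℕ => 729 * C * (n : ℝ) ^ (-(a₀ / 2))) atTop (𝓝 0) := by
    have := ((tendsto_rpow_neg_atTop (by linarith : 0 < a₀ / 2)).comp
      tendsto_natCast_atTop_atTop).const_mul (729 * C)
    simpa using this
  refine tendsto_of_tendsto_of_tendsto_of_le_of_le' tendsto_const_nhds hlim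
    (Eventually.of_forall fun n => measureReal_nonneg) ?_
  filter_upwards [eventually_ge_atTop 1] with n hn
  have h1 := measureReal_quasiGiant_rpow_le hC hn (3 - a₀ / 4)
  have he : (6 : ℝ) - a₀ - 2 * (3 - a₀ / 4) = -(a₀ / 2) := by ring
  rw [he] at h1
  exact h1

/-- **Crux ⟹ QG-NAS** (the second hypothesis of `stub_logBoost` at `p_c`, for every `ε < 1`):
modulo `stub_sizeSplitting` + `stub_logBoost` the crux is EQUIVALENT to this one-bit statement. -/
theorem quasiGiantNotAS_of_freeBoxPowerSaving (h : FreeBoxPowerSaving) {ε : ℝ} (hε : ε < 1) :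
    ∃ a : ℝ, 0 < a ∧ ∀ᶠ n : ℕ in atTop,
      (bondPercolation (zdGraph 3) (criticalProbI 3)).real
        {ω | ∃ u ∈ box 3 n, (n : ℝ) ^ (3 - a) ≤
          (((box 3 n).filter fun v => ω ∈ openConnIn ↑(box 3 n) u v).card : ℝ)} ≤ 1 - ε := by
  obtain ⟨a, ha, hlim⟩ := quasiGiant_tendsto_zero_of_freeBoxPowerSaving h
  exact ⟨a, ha, hlim.eventually (eventually_le_nhds (by linarith))⟩

/-- The foam event of `stub_noCriticalFoam` is contained in the inner quasi-giant event. -/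
theorem foam_subset_quasiGiant (n : ℕ) (s : ℝ) :
    {ω : BondConfig (Site 3) | ∃ u ∈ box 3 n, ∃ u' ∈ box 3 (2 * n),
        s ≤ (((box 3 n).filter fun v => ω ∈ openConnIn ↑(box 3 n) u v).card : ℝ) ∧
        s ≤ (((box 3 (2 * n)).filter fun v => ω ∈ openConnIn ↑(box 3 (2 * n)) u' v).card : ℝ) ∧
        ω ∉ openConnIn ↑(box 3 (2 * n)) u u'} ⊆ quasiGiant n s := by
  rintro ω ⟨u, hu, u', -, h1, -, -⟩
  exact ⟨u, hu, h1⟩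

/-- **Crux ⟹ `stub_noCriticalFoam`** (VERBATIM the registered open stub of skeleton `c888e645…`):
with `a = a₀ / 4` the foam event sits inside `QG(n, n^{3-a})`, whose probability is
`≤ 729 C n^{-a₀/2} → 0`.  So the open stub is NECESSARY for the crux; the skeleton proves it
sufficient modulo three provable stubs; a refutation of the stub would refute the crux. -/
theorem noCriticalFoam_of_freeBoxPowerSaving (h : FreeBoxPowerSaving) :
    ∀ η : ℝ, 0 < η → ∃ a : ℝ, 0 < a ∧ ∀ᶠ n : ℕ in atTop,
      (bondPercolation (zdGraph 3) (criticalProbI 3)).real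
        {ω | ∃ u ∈ box 3 n, ∃ u' ∈ box 3 (2 * n),
          (n : ℝ) ^ (3 - a) ≤
            (((box 3 n).filter fun v => ω ∈ openConnIn ↑(box 3 n) u v).card : ℝ) ∧
          (n : ℝ) ^ (3 - a) ≤
            (((box 3 (2 * n)).filter fun v => ω ∈ openConnIn ↑(box 3 (2 * n)) u' v).card : ℝ) ∧
          ω ∉ openConnIn ↑(box 3 (2 * n)) u u'} ≤ η := by
  intro η hη
  obtain ⟨a, ha, hlim⟩ := quasiGiant_tendsto_zero_of_freeBoxPowerSaving h
  refine ⟨a, ha, ?_⟩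
  filter_upwards [hlim.eventually (eventually_le_nhds hη)] with n hn
  exact (measureReal_mono (foam_subset_quasiGiant n _) (measure_ne_top _ _)).trans hn

/-! ## The foam event is a non-proliferation event -/

/-- **Foam = a fat inner piece AND two distinct fat outer pieces.**  The registered foam event
(`∃ u ∈ B(n), u' ∈ B(2n)` with fat pieces, `u ↮ u'` in `B(2n)`) coincides with "some piece of `B(n)`
has `≥ s` vertices and `B(2n)` carries two pieces with `≥ s` vertices that are not joined inside
`B(2n)`": the outer piece of a fat inner vertex is fat (domain monotonicity), and of two unjoined fat
outer vertices at least one is unjoined from any given inner vertex. -/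
theorem foam_iff_two_fat_outer (n : ℕ) (s : ℝ) (ω : BondConfig (Site 3)) :
    (∃ u ∈ box 3 n, ∃ u' ∈ box 3 (2 * n),
        s ≤ (((box 3 n).filter fun v => ω ∈ openConnIn ↑(box 3 n) u v).card : ℝ) ∧
        s ≤ (((box 3 (2 * n)).filter fun v => ω ∈ openConnIn ↑(box 3 (2 * n)) u' v).card : ℝ) ∧
        ω ∉ openConnIn ↑(box 3 (2 * n)) u u') ↔
    ((∃ u ∈ box 3 n, s ≤ (((box 3 n).filter fun v => ω ∈ openConnIn ↑(box 3 n) u v).card : ℝ)) ∧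
      ∃ w ∈ box 3 (2 * n), ∃ w' ∈ box 3 (2 * n),
        s ≤ (((box 3 (2 * n)).filter fun v => ω ∈ openConnIn ↑(box 3 (2 * n)) w v).card : ℝ) ∧
        s ≤ (((box 3 (2 * n)).filter fun v => ω ∈ openConnIn ↑(box 3 (2 * n)) w' v).card : ℝ) ∧
        ω ∉ openConnIn ↑(box 3 (2 * n)) w w') := by
  have hsub : box 3 n ⊆ box 3 (2 * n) := box_mono 3 (by omega)
  -- the outer piece of `u` contains its inner piece
  have hmono : ∀ u : Site 3,
      ((box 3 n).filter fun v => ω ∈ openConnIn ↑(box 3 n) u v) ⊆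
        ((box 3 (2 * n)).filter fun v => ω ∈ openConnIn ↑(box 3 (2 * n)) u v) := by
    intro u v hv
    rw [Finset.mem_filter] at hv ⊢
    exact ⟨hsub hv.1, openConnIn_mono (Finset.coe_subset.2 hsub) u v hv.2⟩
  have hcard_mono : ∀ u : Site 3,
      (((box 3 n).filter fun v => ω ∈ openConnIn ↑(box 3 n) u v).card : ℝ) ≤
        (((box 3 (2 * n)).filter fun v => ω ∈ openConnIn ↑(box 3 (2 * n)) u v).card : ℝ) :=
    fun u => by exact_mod_cast Finset.card_le_card (hmono u)
  constructor
  · rintro ⟨u, hu, u', hu', h1, h2, h3⟩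
    exact ⟨⟨u, hu, h1⟩, u, hsub hu, u', hu', h1.trans (hcard_mono u), h2, h3⟩
  · rintro ⟨⟨u, hu, h1⟩, w, hw, w', hw', h2, h3, h4⟩
    by_cases huw : ω ∈ openConnIn (↑(box 3 (2 * n)) : Set (Site 3)) u w
    · -- `u ↔ w`, so `u ↮ w'` (else `w ↔ w'`)
      refine ⟨u, hu, w', hw', h1, h3, fun huw' => h4 ?_⟩
      exact GM.openConnIn_trans (openConnIn_symm_mem huw) huw'
    · exact ⟨u, hu, w, hw, h1, h2, huw⟩

/-- **Crux ⟹ `stub_boundaryQuasiGiantsNotAS`** (VERBATIM the sibling skeleton's hardest stub: with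
probability `≥ ε` no boundary-touching piece of `B(n)` has `≥ n^{3-a}` vertices, eventually): the
boundary quasi-giant event lies inside `QG(n, n^{3-a})`, whose probability tends to `0` under the crux. -/
theorem boundaryQuasiGiantsNotAS_of_freeBoxPowerSaving (h : FreeBoxPowerSaving) :
    ∃ a ε : ℝ, 0 < a ∧ 0 < ε ∧ ∀ᶠ n : ℕ in atTop,
      (bondPercolation (zdGraph 3) (criticalProbI 3)).real
        {ω | ∃ u ∈ innerBoundary (zdGraph 3) (box 3 n), (n : ℝ) ^ (3 - a) ≤
          (((box 3 n).filter fun v => ω ∈ openConnIn ↑(box 3 n) u v).card : ℝ)} ≤ 1 - ε := by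
  obtain ⟨a, ha, hlim⟩ := quasiGiant_tendsto_zero_of_freeBoxPowerSaving h
  refine ⟨a, 1 / 2, ha, by norm_num, ?_⟩
  filter_upwards [hlim.eventually (eventually_le_nhds (by norm_num : (0 : ℝ) < 1 - 1 / 2))] with n hn
  refine le_trans (measureReal_mono ?_ (measure_ne_top _ _)) hn
  rintro ω ⟨u, hu, h1⟩
  exact ⟨u, (mem_innerBoundary_iff.1 hu).1, h1⟩

end

end Summit.CriticalPhenomena.PercolationContinuityZ3.FreeBoxPowerSavingNegative
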